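import Literature.Probability.LatticeModels.BrillouinRiemannSumUniform
import Literature.Probability.LatticeModels.GreenBlockSum

/-!
# Momentum sums of BOUNDED symbols continuous off `p = 0` converge to Brillouin-zone integrals
# (the `T ↗ ℤ^d` step for propagator entries with a direction-dependent limit at zero momentum)

HONEST FRAMING (page 1 of everything in this package): discharging `BetaPertH` makes Bałaban's UV stability
UNCONDITIONAL — a real constructive-QFT result; it is NOT the continuum limit and NOT the Clay problem.  This module is
pure lattice analysis (unit `b2b-balaban-beta-an5` gen 8, journal node `BETA-an5-g8-PUNCTURED-RS`; cell record
`HOME/GAPS.md` G-an5g8-2, route (ii-a)); it asserts nothing about Bałaban's operators.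

## What and why

lit1's `BrillouinRiemannSum.tendsto_cornerRiemannSum` / `BrillouinRiemannSumUniform.momentumAverage_uniform_approx`
pass from the momentum sums `L^{-d} Σ_{k ∈ (ℤ/Lℤ)^d} G(2πk/L)` of a finite torus to `(2π)^{-d}∫_{[-π,π]^d} G` for
`G` CONTINUOUS on the closed zone.  The entries of the block propagators behind the `β` sub-cell's window certificates
(`Beta.WoodburyFibre`, `Beta.WoodburyCovariant`, `Beta.LongitudinalWindow`: King's fibre matrices at `c = N²`,
functions of the momentum only through the angles `θ = 2πk/(N M)`) are, after the massless free part is split off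
(`Beta.FreeLegDictionary`), momentum sums of symbols that are BOUNDED on the zone and continuous AWAY FROM `θ = 0`,
but in general have a direction-dependent limit at `θ = 0` (ratios of the type `sin²(θ_μ/2)/Σ_ν sin²(θ_ν/2)`).  The
volume limit `T ↗ ℤ^d` of such entries ([Balaban1987RG1] p. 264, after (1.21): «Now we take a limit of these
functions as T^{(j+1)} ↗ Z^d. This limit exists by the localized representation (1.7).» — read as image on the render
`1987-cmp109-rg-I-small-field-p016-x2.png`; LOCATOR only) is therefore NOT covered by the continuous case.  This file
proves the punctured case:

* `card_nearCells_mul_le` — the cells whose corner lies in the `η`-box around `0` have total volume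
  `#near · δ^d ≤ (2η + δ)^d` (`δ = 2π/L`, even `L`; injection `j ↦ m_j` into the integer box `|m_i| ≤ ⌊η/δ⌋`);
* `farRegion_subset_brillouin_diff` — the far region `{p ∈ zone : ∃ i, η ≤ |p_i|}` (`η > 0`) misses the origin;
* **`cornerRiemannSum_punctured_approx`** — for `G : [-π,π]^d → E` (real Banach space) with `‖G‖ ≤ B` on the zone,
  continuous on the zone minus `{0}`, integrable on the zone, `d ≥ 1`: for every `ε > 0` there is `L₀` with
  `‖δ^d Σ_j G(c_j) − ∫_{[-π,π]^d} G‖ ≤ ε` for all EVEN `L ≥ L₀` (far cells: uniform continuity on the compact far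
  region, as in lit1; near cells: `2B · #near · δ^d ≤ 2B(3η)^d ≤ 2B 3^d η`);
* **`momentumAverage_punctured_approx`** — the normalised momentum form for `2π`-periodic `G`:
  `‖L^{-d} Σ_{k ∈ (ℤ/Lℤ)^d} G(2πk/L) − (2π)^{-d} ∫_{[-π,π]^d} G‖ ≤ ε` for all even `L ≥ L₀`;
* `integrableOn_brillouin_of_norm_le` — the integrability hypothesis is automatic (`d ≥ 1`: `{0}` is Lebesgue-null).
* v1.1 (append-only) — THE SINGULAR CLASS (`d ≥ 3`): **`cornerRiemannSum_singular_approx`** /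
  **`momentumAverage_singular_approx`** for `G` continuous off `0` with `‖G(p)‖ ≤ C₀ + C₁/ε(p)` (`p ≠ 0`), zero momentum
  EXCLUDED: `‖L^{-d} Σ_{k ≠ 0} G(2πk/L) − (2π)^{-d} ∫_{[-π,π]^d} G‖ ≤ ε` along even `L` — the class of the Woodbury /
  massive parts of the an5 certificates (`WoodburyFibre.fibre_term_le`: `‖κ A_q Ā_q‖ ≤ 2/σ₀ + const`, `σ₀ ≥ 2N²ε(θ)`);
  with `integrableOn_brillouin_of_norm_le_inv_dispersion`, `cellCorner_ne_zero`, `greenIntegrand_zero_eq`.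

Evenness of `L` is inherited from lit1's corner reindexing (`sum_latticeMomentum_eq_sum_cellCorner`); print's scale-`k`
tori have even periods `2L_μ` ((0.1), p. 251; cell record D-pv01.7), so it costs nothing there.  References for the
continuous case (the argument is the same plus the near/far split of `LatticeGreenRiemannSum`): Friedli–Velenik 2017
§10.4 [FriedliVelenik2017]; Benfatto–Giuliani–Mastropietro 2006 eqs. (1.4), (2.4) [BenfattoGiulianiMastropietro2006].
Every statement below is folklore real analysis, proved here in the kernel; nothing is cited as a hypothesis.
-/

noncomputable section

namespace Literature.MathematicalPhysics.QuantumFieldTheory.Balaban1983to89.Beta.PuncturedRiemannSum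

open MeasureTheory Filter Topology Finset Real
open Literature.Probability.LatticeModels

variable {d : ℕ} {E : Type*} [NormedAddCommGroup E] [NormedSpace ℝ E] [CompleteSpace E]

/-! ### Geometry of the near and far cells -/

/-- `0 ∈ [-π,π]^d`. [folklore] -/
theorem zero_mem_brillouin : (0 : Fin d → ℝ) ∈ brillouin d := fun i _ => by
  simp only [Pi.zero_apply, Set.mem_Icc]
  constructor <;> linarith [Real.pi_pos]

/-- The far region (`η > 0`) misses the origin: `farRegion d η ⊆ [-π,π]^d ∖ {0}`. [folklore] -/
theorem farRegion_subset_brillouin_diff {η : ℝ} (hη : 0 < η) :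
    farRegion d η ⊆ brillouin d \ {0} := by
  rintro p ⟨hpB, i, hi⟩
  refine ⟨hpB, ?_⟩
  rintro rfl
  simp only [Pi.zero_apply, abs_zero] at hi
  linarith

/-- **Total volume of the near cells**: for even `L` and `η ≥ 0`, `#(nearCells d L η) · δ^d ≤ (2η + δ)^d`
(the offsets `m_j = j − L/2` of the near cells are distinct integer vectors with `|m_{j,i}| ≤ η/δ`). [folklore] -/
theorem card_nearCells_mul_le {L : ℕ} [NeZero L] (hL : Even L) {η : ℝ} (hη : 0 ≤ η) :
    (#(nearCells d L η) : ℝ) * gridStep L ^ d ≤ (2 * η + gridStep L) ^ d := by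
  have hδ := gridStep_pos L
  set K : ℕ := ⌊η / gridStep L⌋₊ with hK
  set box : Finset (Fin d → ℤ) := Fintype.piFinset fun _ => Finset.Icc (-(K : ℤ)) K with hbox
  have hmap : ∀ j ∈ nearCells d L η, cellOffset j ∈ box := by
    intro j hj
    rw [hbox, Fintype.mem_piFinset]
    intro i
    have hji : |cellCorner j i| ≤ η := (Finset.mem_filter.1 hj).2 i
    rw [cellCorner_eq_gridStep_mul hL j i, abs_mul, abs_of_pos hδ] at hji
    have h1 : |(cellOffset j i : ℝ)| ≤ η / gridStep L := by
      rw [le_div_iff₀ hδ]; linarith [mul_comm (gridStep L) |(cellOffset j i : ℝ)|]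
    have h2 : |(cellOffset j i : ℝ)| < (K : ℝ) + 1 := h1.trans_lt (Nat.lt_floor_add_one _)
    have h3 : |cellOffset j i| < (K : ℤ) + 1 := by
      have : ((|cellOffset j i| : ℤ) : ℝ) < (K : ℝ) + 1 := by rw [Int.cast_abs]; exact h2
      exact_mod_cast this
    have h4 : |cellOffset j i| ≤ (K : ℤ) := by omega
    rw [Finset.mem_Icc]
    constructor <;> linarith [(abs_le.1 h4).1, (abs_le.1 h4).2]
  have hcard : #(nearCells d L η) ≤ #box :=
    Finset.card_le_card_of_injOn cellOffset hmap ((cellOffset_injective d L).injOn)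
  have hbox_card : #box = (2 * K + 1) ^ d := by
    rw [hbox, Fintype.card_piFinset, Finset.prod_const, Finset.card_univ, Fintype.card_fin, Int.card_Icc]
    congr 1
    omega
  have hKη : (K : ℝ) * gridStep L ≤ η := by
    have := Nat.floor_le (div_nonneg hη hδ.le)
    rw [← hK] at this
    calc (K : ℝ) * gridStep L ≤ η / gridStep L * gridStep L := by gcongr
      _ = η := div_mul_cancel₀ η hδ.ne'
  have hc : (#(nearCells d L η) : ℝ) ≤ ((2 * K + 1 : ℕ) : ℝ) ^ d := by
    have : (#(nearCells d L η) : ℝ) ≤ (#box : ℝ) := by exact_mod_cast hcard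
    rw [hbox_card] at this
    exact_mod_cast this
  calc (#(nearCells d L η) : ℝ) * gridStep L ^ d ≤ ((2 * K + 1 : ℕ) : ℝ) ^ d * gridStep L ^ d := by gcongr
    _ = (((2 * K + 1 : ℕ) : ℝ) * gridStep L) ^ d := by rw [mul_pow]
    _ ≤ (2 * η + gridStep L) ^ d := by
        gcongr
        push_cast
        nlinarith

omit [CompleteSpace E] in
/-- A corner value is bounded by the sup bound: `‖δ^d • G(c_j)‖ ≤ δ^d B`. [folklore] -/
theorem norm_smul_corner_le {L : ℕ} [NeZero L] {G : (Fin d → ℝ) → E} {B : ℝ}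
    (hB : ∀ p ∈ brillouin d, ‖G p‖ ≤ B) (j : TorusSite d L) :
    ‖(gridStep L) ^ d • G (cellCorner j)‖ ≤ gridStep L ^ d * B := by
  rw [norm_smul, Real.norm_of_nonneg (pow_nonneg (gridStep_pos L).le d)]
  exact mul_le_mul_of_nonneg_left (hB _ (cellCorner_mem_brillouin j)) (pow_nonneg (gridStep_pos L).le d)

omit [CompleteSpace E] in
/-- A cell integral is bounded by the sup bound times the cell volume: `‖∫_{cell_j} G‖ ≤ δ^d B`. [folklore] -/
theorem norm_setIntegral_gridCell_le {L : ℕ} [NeZero L] {G : (Fin d → ℝ) → E} {B : ℝ}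
    (hB : ∀ p ∈ brillouin d, ‖G p‖ ≤ B) (j : TorusSite d L) :
    ‖∫ p in gridCell j, G p‖ ≤ gridStep L ^ d * B := by
  have hvol : volume.real (gridCell j) = gridStep L ^ d := by
    rw [Measure.real, volume_gridCell_toReal]
  have h := norm_setIntegral_le_of_norm_le_const (volume_gridCell_lt_top j) (f := G) (C := B)
    fun p hp => hB p (gridCell_subset_brillouin j hp)
  rw [hvol] at h
  linarith

/-! ### Integrability is automatic -/

omit [NormedSpace ℝ E] [CompleteSpace E] in
/-- For `d ≥ 1` a function bounded on `[-π,π]^d` and continuous on `[-π,π]^d ∖ {0}` is integrable on the zone (the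
origin is Lebesgue-null). [folklore] -/
theorem integrableOn_brillouin_of_norm_le (hd : 0 < d) {G : (Fin d → ℝ) → E} {B : ℝ}
    (hG : ContinuousOn G (brillouin d \ {0})) (hB : ∀ p ∈ brillouin d, ‖G p‖ ≤ B) :
    IntegrableOn G (brillouin d) volume := by
  haveI : Nonempty (Fin d) := ⟨⟨0, hd⟩⟩
  have hmeas : MeasurableSet (brillouin d \ {0}) :=
    (measurableSet_brillouin d).diff (measurableSet_singleton 0)
  have hsub : brillouin d \ {0} ⊆ brillouin d := fun p hp => hp.1
  have hfin : volume (brillouin d \ {0}) < ⊤ :=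
    (measure_mono hsub).trans_lt (isCompact_brillouin d).measure_lt_top
  have h1 : IntegrableOn G (brillouin d \ {0}) volume :=
    ⟨hG.aestronglyMeasurable hmeas, HasFiniteIntegral.restrict_of_bounded B hfin
      ((ae_restrict_iff' hmeas).2 (Eventually.of_forall fun p hp => hB p hp.1))⟩
  have h0 : volume ({0} : Set (Fin d → ℝ)) = 0 := measure_singleton 0
  exact h1.congr_set_ae (sdiff_null_ae_eq_self h0).symm

/-! ### The punctured Riemann-sum theorem -/

/-- **Corner Riemann sums of a bounded symbol continuous off the origin converge** (`d ≥ 1`, even `L`): for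
`G : [-π,π]^d → E` with `‖G‖ ≤ B` on the zone, continuous on the zone minus `{0}` and integrable on the zone, and
`ε > 0`, there is `L₀` with `‖δ^d Σ_j G(c_j) − ∫_{[-π,π]^d} G‖ ≤ ε` for all even `L ≥ L₀`.  Far cells (corner outside the
`η`-box) lie in the compact far region where `G` is uniformly continuous — total error `≤ (2π)^d ω`; near cells carry at
most `2B` times their total volume `(2η + δ)^d ≤ 3^d η`. [folklore] -/
theorem cornerRiemannSum_punctured_approx (hd : 0 < d) {G : (Fin d → ℝ) → E} {B : ℝ}
    (hG : ContinuousOn G (brillouin d \ {0})) (hB : ∀ p ∈ brillouin d, ‖G p‖ ≤ B)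
    (hint : IntegrableOn G (brillouin d) volume) {ε : ℝ} (hε : 0 < ε) :
    ∃ L₀ : ℕ, ∀ (L : ℕ) [NeZero L], Even L → L₀ ≤ L →
      ‖cornerRiemannSum G L - ∫ p in brillouin d, G p‖ ≤ ε := by
  have hB0 : 0 ≤ B := (norm_nonneg _).trans (hB 0 zero_mem_brillouin)
  have h2π : (0 : ℝ) < (2 * π) ^ d := by positivity
  have h3d : (0 : ℝ) < (3 : ℝ) ^ d := by positivity
  -- the size `η` of the excised box: near cells cost `2 B 3^d η ≤ 2ε/3`
  set η : ℝ := min 1 (ε / (3 * (B * 3 ^ d + 1))) with hη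
  have hη_pos : 0 < η := lt_min one_pos (by positivity)
  have hη1 : η ≤ 1 := min_le_left _ _
  have hηε : B * 3 ^ d * η ≤ ε / 3 := by
    have h : η ≤ ε / (3 * (B * 3 ^ d + 1)) := min_le_right _ _
    rw [le_div_iff₀ (by positivity)] at h
    nlinarith [hη_pos, hB0, h3d]
  -- far cells: uniform continuity on the compact far region, tolerance `ε₁ = ε / (3 (2π)^d)`
  set ε₁ : ℝ := ε / (3 * (2 * π) ^ d) with hε₁
  have hε₁_pos : 0 < ε₁ := by positivity
  have huc : UniformContinuousOn G (farRegion d (η / 2)) :=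
    (isCompact_farRegion d (η / 2)).uniformContinuousOn_of_continuous
      (hG.mono (farRegion_subset_brillouin_diff (by positivity)))
  obtain ⟨η', hη', hUC⟩ := Metric.uniformContinuousOn_iff_le.1 huc ε₁ hε₁_pos
  -- threshold: grid step below `min (η/2) η'`
  set m : ℝ := min (η / 2) η' with hm
  have hm_pos : 0 < m := lt_min (by positivity) hη'
  obtain ⟨L₀, hL₀⟩ := exists_nat_gt (2 * π / m)
  refine ⟨L₀, fun L _ hLe hL₀L => ?_⟩
  have hL : 2 * π / m < L := lt_of_lt_of_le hL₀ (by exact_mod_cast hL₀L)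
  have hLpos : (0 : ℝ) < L := lt_trans (by positivity) hL
  have hδ : gridStep L ≤ m := by
    unfold gridStep
    rw [div_le_iff₀ hLpos]
    rw [div_lt_iff₀ hm_pos] at hL
    linarith
  have hδη2 : gridStep L ≤ η / 2 := hδ.trans (min_le_left _ _)
  have hδη' : gridStep L ≤ η' := hδ.trans (min_le_right _ _)
  have hδη : gridStep L ≤ η := by linarith
  have hδpos := gridStep_pos L
  set N := nearCells d L η with hN
  set X : TorusSite d L → E := fun j => (gridStep L) ^ d • G (cellCorner j) - ∫ p in gridCell j, G p with hX
  -- the difference as a sum over cells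
  have hdiff : cornerRiemannSum G L - ∫ p in brillouin d, G p = ∑ j, X j := by
    rw [cornerRiemannSum_eq, setIntegral_brillouin_eq_sum_gridCell' L hint, ← Finset.sum_sub_distrib]
  -- (a) far cells
  have hfar : ∀ j ∈ univ \ N, ‖X j‖ ≤ ε₁ * gridStep L ^ d := by
    intro j hj
    have hjN : j ∉ N := (Finset.mem_sdiff.1 hj).2
    have hsub := gridCell_subset_farRegion hδη2 hjN
    have hintj : IntegrableOn G (gridCell j) volume := hint.mono_set (gridCell_subset_brillouin j)
    have hvol : volume.real (gridCell j) = gridStep L ^ d := by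
      rw [Measure.real, volume_gridCell_toReal]
    have hc : IntegrableOn (fun _ : Fin d → ℝ => G (cellCorner j)) (gridCell j) volume :=
      integrableOn_const (hs := (volume_gridCell_lt_top j).ne)
    simp only [hX]
    rw [smul_eq_setIntegral_const j, ← integral_sub hc hintj, ← hvol]
    refine norm_setIntegral_le_of_norm_le_const (volume_gridCell_lt_top j) fun p hp => ?_
    rw [← dist_eq_norm, dist_comm]
    exact hUC p (hsub hp) (cellCorner j) (hsub (cellCorner_mem_gridCell j))
      ((dist_cellCorner_le_of_mem_gridCell hp).trans hδη')
  have hcardfar : (#(univ \ N) : ℝ) * gridStep L ^ d ≤ (2 * π) ^ d := by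
    have h1 : (#(univ \ N) : ℝ) ≤ (L : ℝ) ^ d := by
      have := Finset.card_le_univ (univ \ N)
      rw [card_torusSite] at this
      exact_mod_cast this
    calc (#(univ \ N) : ℝ) * gridStep L ^ d ≤ (L : ℝ) ^ d * gridStep L ^ d := by gcongr
      _ = (2 * π) ^ d := by rw [← mul_pow, mul_comm, gridStep_mul]
  have ha : ∑ j ∈ univ \ N, ‖X j‖ ≤ ε / 3 := by
    calc ∑ j ∈ univ \ N, ‖X j‖ ≤ ∑ _j ∈ univ \ N, ε₁ * gridStep L ^ d := Finset.sum_le_sum hfar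
      _ = ε₁ * (#(univ \ N) * gridStep L ^ d) := by rw [sum_const, nsmul_eq_mul]; ring
      _ ≤ ε₁ * (2 * π) ^ d := by gcongr
      _ = ε / 3 := by rw [hε₁]; field_simp
  -- (b) near cells
  have hnear : ∀ j ∈ N, ‖X j‖ ≤ 2 * B * gridStep L ^ d := by
    intro j _
    calc ‖X j‖ ≤ ‖(gridStep L) ^ d • G (cellCorner j)‖ + ‖∫ p in gridCell j, G p‖ := norm_sub_le _ _
      _ ≤ gridStep L ^ d * B + gridStep L ^ d * B :=
          add_le_add (norm_smul_corner_le hB j) (norm_setIntegral_gridCell_le hB j)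
      _ = 2 * B * gridStep L ^ d := by ring
  have hvolnear : (#N : ℝ) * gridStep L ^ d ≤ 3 ^ d * η := by
    have h1 := card_nearCells_mul_le (d := d) hLe hη_pos.le
    have h2 : (2 * η + gridStep L) ^ d ≤ (3 * η) ^ d := by
      gcongr
      linarith
    have h3 : (3 * η) ^ d ≤ 3 ^ d * η := by
      rw [mul_pow]
      gcongr
      calc η ^ d ≤ η ^ 1 := pow_le_pow_of_le_one hη_pos.le hη1 hd
        _ = η := pow_one η
    exact h1.trans (h2.trans h3)
  have hb : ∑ j ∈ N, ‖X j‖ ≤ 2 * (ε / 3) := by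
    calc ∑ j ∈ N, ‖X j‖ ≤ ∑ _j ∈ N, 2 * B * gridStep L ^ d := Finset.sum_le_sum hnear
      _ = 2 * B * (#N * gridStep L ^ d) := by rw [sum_const, nsmul_eq_mul]; ring
      _ ≤ 2 * B * (3 ^ d * η) := by gcongr
      _ = 2 * (B * 3 ^ d * η) := by ring
      _ ≤ 2 * (ε / 3) := by gcongr
  -- combine
  rw [hdiff]
  calc ‖∑ j, X j‖ ≤ ∑ j, ‖X j‖ := norm_sum_le _ _
    _ = ∑ j ∈ univ \ N, ‖X j‖ + ∑ j ∈ N, ‖X j‖ := (Finset.sum_sdiff (subset_univ N)).symm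
    _ ≤ ε / 3 + 2 * (ε / 3) := add_le_add ha hb
    _ = ε := by ring

/-- **Momentum averages of a bounded, `2π`-periodic symbol continuous off the origin converge to its Brillouin-zone
average** (`d ≥ 1`): `‖L^{-d} Σ_{k ∈ (ℤ/Lℤ)^d} G(2πk/L) − (2π)^{-d}∫_{[-π,π]^d} G‖ ≤ ε` for all EVEN `L ≥ L₀(ε)`.
This is the `T ↗ ℤ^d` step for a translation-invariant torus operator whose symbol is bounded with a
direction-dependent limit at zero momentum. [folklore] -/
theorem momentumAverage_punctured_approx (hd : 0 < d) {G : (Fin d → ℝ) → E} {B : ℝ}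
    (hG : ContinuousOn G (brillouin d \ {0})) (hB : ∀ p ∈ brillouin d, ‖G p‖ ≤ B)
    (hper : ∀ (p : Fin d → ℝ) (n : Fin d → ℤ), G (fun i => p i + 2 * π * (n i : ℝ)) = G p)
    {ε : ℝ} (hε : 0 < ε) :
    ∃ L₀ : ℕ, ∀ (L : ℕ) [NeZero L], Even L → L₀ ≤ L →
      ‖((L ^ d : ℕ) : ℝ)⁻¹ • ∑ k : TorusSite d L, G (latticeMomentum L k) -
          ((2 * π) ^ d)⁻¹ • ∫ p in brillouin d, G p‖ ≤ ε := by
  have h2π : (0 : ℝ) < (2 * π) ^ d := by positivity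
  have hint := integrableOn_brillouin_of_norm_le hd hG hB
  obtain ⟨L₀, hL₀⟩ := cornerRiemannSum_punctured_approx hd hG hB hint (ε := (2 * π) ^ d * ε) (by positivity)
  refine ⟨L₀, fun L _ hev hL => ?_⟩
  have h := hL₀ L hev hL
  have hsum : ∑ k : TorusSite d L, G (latticeMomentum L k) = ∑ j : TorusSite d L, G (cellCorner j) :=
    sum_latticeMomentum_eq_sum_cellCorner hev hper
  have hcs : cornerRiemannSum G L =
      (2 * π) ^ d • (((L ^ d : ℕ) : ℝ)⁻¹ • ∑ k : TorusSite d L, G (latticeMomentum L k)) := by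
    rw [cornerRiemannSum_eq, ← Finset.smul_sum, hsum, smul_smul]
    congr 1
    have hL0 : (L : ℝ) ^ d ≠ 0 := pow_ne_zero d (by exact_mod_cast NeZero.ne L)
    rw [← gridStep_mul L, mul_pow]
    push_cast
    rw [mul_inv_cancel_right₀ hL0]
  have key : (2 * π) ^ d • (((L ^ d : ℕ) : ℝ)⁻¹ • ∑ k : TorusSite d L, G (latticeMomentum L k) -
      ((2 * π) ^ d)⁻¹ • ∫ p in brillouin d, G p) =
      cornerRiemannSum G L - ∫ p in brillouin d, G p := by
    rw [smul_sub, hcs, ← mul_smul ((2 * π) ^ d) (((2 * π) ^ d)⁻¹), mul_inv_cancel₀ h2π.ne', one_smul]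
  have hn : ‖(2 * π) ^ d • (((L ^ d : ℕ) : ℝ)⁻¹ • ∑ k : TorusSite d L, G (latticeMomentum L k) -
      ((2 * π) ^ d)⁻¹ • ∫ p in brillouin d, G p)‖ ≤ (2 * π) ^ d * ε := by
    rw [key]; exact h
  rw [norm_smul, Real.norm_of_nonneg h2π.le] at hn
  exact le_of_mul_le_mul_left hn h2π


/-! ### v1.1 (append-only) — the SINGULAR punctured case (`d ≥ 3`): majorant `C₀ + C₁/ε(p)`, zero momentum excluded

The massive parts of the an5 certificates are NOT bounded at zero momentum: the Woodbury kernel of `Beta.WoodburyFibre`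
(`Rperp = |T|⁻¹ Σ_{q ≠ 0} κ(q) A_q(x) conj A_q(x′)`) has, per fibre, `‖κ A_q Ā_q‖ ≤ 2/σ₀(q) + const` with
`σ₀ = m² + N²Σ_μ(2 − 2cos θ_μ) ≥ 2N² ε(θ)` (`WoodburyFibre.fibre_term_le`) — an integrable `1/ε` singularity, summed over
`q ≠ 0`.  The theorems below treat exactly this class: `G` continuous on the zone minus `{0}` with
`‖G(p)‖ ≤ C₀ + C₁/ε(p)` for `p ≠ 0`, `d ≥ 3`, the Riemann sum omitting the central cell / the zero momentum.  The near-cell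
singular parts are controlled by lit1's `LatticeGreenRiemannSum` lemmas AT `z = 0` (`h_0 = 1/ε`:
`sum_nearCells_abs_greenIntegrand_le`, `sum_nearCells_integral_abs_le`, `exists_setIntegral_punctBall_le`). -/

/-- lit1's Green integrand at `z = 0` is `1/ε`. [folklore] -/
theorem greenIntegrand_zero_eq (p : Fin d → ℝ) : greenIntegrand (0 : Site d) p = 1 / dispersion p := by
  simp [greenIntegrand]

/-- `|h_0(p)| = 1/ε(p)` (`ε ≥ 0`). [folklore] -/
theorem abs_greenIntegrand_zero_eq (p : Fin d → ℝ) : |greenIntegrand (0 : Site d) p| = 1 / dispersion p := by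
  rw [greenIntegrand_zero_eq, abs_of_nonneg (div_nonneg zero_le_one (dispersion_nonneg p))]

/-- For even `L`, a cell other than the central one has a nonzero corner. [folklore] -/
theorem cellCorner_ne_zero {L : ℕ} [NeZero L] (hL : Even L) {j : TorusSite d L} (hj : j ≠ centerIndex d L) :
    cellCorner j ≠ 0 := by
  intro h
  apply hj
  rw [← cellOffset_eq_zero_iff]
  funext i
  have hi := congr_fun h i
  rw [cellCorner_eq_gridStep_mul hL j i, Pi.zero_apply] at hi
  rcases mul_eq_zero.1 hi with h1 | h2
  · exact absurd h1 (gridStep_pos L).ne'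
  · simp only [Pi.zero_apply]
    exact_mod_cast h2

omit [NormedSpace ℝ E] [CompleteSpace E] in
/-- Integrability on the zone from the singular majorant (`d ≥ 3`: `1/ε` is integrable, `{0}` is null). [folklore] -/
theorem integrableOn_brillouin_of_norm_le_inv_dispersion (hd : 3 ≤ d) {G : (Fin d → ℝ) → E} {C₀ C₁ : ℝ}
    (hG : ContinuousOn G (brillouin d \ {0}))
    (hB : ∀ p ∈ brillouin d, p ≠ 0 → ‖G p‖ ≤ C₀ + C₁ / dispersion p) :
    IntegrableOn G (brillouin d) volume := by
  haveI : Nonempty (Fin d) := ⟨⟨0, by omega⟩⟩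
  set f := (brillouin d).indicator (fun p : Fin d → ℝ => 1 / dispersion p) with hf
  have hfi : Integrable f volume := integrable_indicator_inv_dispersion d hd
  have hmeas : MeasurableSet (brillouin d \ {0}) :=
    (measurableSet_brillouin d).diff (measurableSet_singleton 0)
  have hsub : brillouin d \ {0} ⊆ brillouin d := fun p hp => hp.1
  have hfin : volume (brillouin d \ {0}) < ⊤ :=
    (measure_mono hsub).trans_lt (isCompact_brillouin d).measure_lt_top
  haveI : IsFiniteMeasure (volume.restrict (brillouin d \ {0})) := ⟨by rwa [Measure.restrict_apply_univ]⟩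
  have hg : Integrable (fun p => C₀ + C₁ * f p) (volume.restrict (brillouin d \ {0})) :=
    (integrable_const C₀).add (hfi.const_mul C₁).restrict
  have h1 : IntegrableOn G (brillouin d \ {0}) volume := by
    refine Integrable.mono' hg (hG.aestronglyMeasurable hmeas) ?_
    refine (ae_restrict_iff' hmeas).2 (Eventually.of_forall fun p hp => ?_)
    have hp0 : p ≠ 0 := fun h => hp.2 h
    rw [hf, Set.indicator_of_mem hp.1]
    calc ‖G p‖ ≤ C₀ + C₁ / dispersion p := hB p hp.1 hp0
      _ = C₀ + C₁ * (1 / dispersion p) := by ring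
  have h0 : volume ({0} : Set (Fin d → ℝ)) = 0 := measure_singleton 0
  exact h1.congr_set_ae (sdiff_null_ae_eq_self h0).symm

/-- **Punctured corner Riemann sums of a symbol with an integrable `1/ε` singularity converge** (`d ≥ 3`, even `L`):
for `G : [-π,π]^d → E` continuous on the zone minus `{0}` with `‖G(p)‖ ≤ C₀ + C₁/ε(p)` (`p ≠ 0`), and `ε > 0`, there is
`L₀` such that `‖δ^d Σ_{j ≠ j₀} G(c_j) − ∫_{[-π,π]^d} G‖ ≤ ε` for all even `L ≥ L₀`, `j₀` the cell cornered at the origin.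
Far cells as in the bounded case; near cells: the `C₀` part by the cell count, the `C₁/ε` part by lit1's near-cell
lemmas for `h_0 = 1/ε` (grid part `≤ π² d 3^{d-1} η^{d-2}`, integral part by absolute continuity). [folklore] -/
theorem cornerRiemannSum_singular_approx (hd : 3 ≤ d) {G : (Fin d → ℝ) → E} {C₀ C₁ : ℝ}
    (hC₀ : 0 ≤ C₀) (hC₁ : 0 ≤ C₁) (hG : ContinuousOn G (brillouin d \ {0}))
    (hB : ∀ p ∈ brillouin d, p ≠ 0 → ‖G p‖ ≤ C₀ + C₁ / dispersion p) {ε : ℝ} (hε : 0 < ε) :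
    ∃ L₀ : ℕ, ∀ (L : ℕ) [NeZero L], Even L → L₀ ≤ L →
      ‖(∑ j ∈ (univ : Finset (TorusSite d L)).erase (centerIndex d L), (gridStep L) ^ d • G (cellCorner j)) -
          ∫ p in brillouin d, G p‖ ≤ ε := by
  have hd1 : 1 ≤ d := by omega
  have hd0 : (0 : ℝ) < d := by exact_mod_cast (by omega : 0 < d)
  have hint := integrableOn_brillouin_of_norm_le_inv_dispersion hd hG hB
  have hI0 := integrableOn_greenIntegrand d hd (0 : Site d)
  have h2π : (0 : ℝ) < (2 * π) ^ d := by positivity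
  have h3d : (0 : ℝ) < (3 : ℝ) ^ d := by positivity
  set f := (brillouin d).indicator (fun p : Fin d → ℝ => 1 / dispersion p) with hf
  set K₁ : ℝ := π ^ 2 * d * 3 ^ (d - 1) with hK₁
  have hK₁_pos : 0 < K₁ := by positivity
  -- (1) the near integrals of `1/ε`
  obtain ⟨t, ht, hnearI⟩ := exists_setIntegral_punctBall_le d hd (ε := ε / (8 * (C₁ + 1))) (by positivity)
  -- (2) the size `η` of the excised box
  set η : ℝ := min (min 1 (t / 2)) (ε / (8 * (C₀ * 3 ^ d + C₁ * K₁ + 1))) with hη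
  have hη_pos : 0 < η := lt_min (lt_min one_pos (by positivity)) (by positivity)
  have hη1 : η ≤ 1 := (min_le_left _ _).trans (min_le_left _ _)
  have hηt : 2 * η ≤ t := by
    have : η ≤ t / 2 := (min_le_left _ _).trans (min_le_right _ _)
    linarith
  have hηε : (C₀ * 3 ^ d + C₁ * K₁) * η ≤ ε / 8 := by
    have h : η ≤ ε / (8 * (C₀ * 3 ^ d + C₁ * K₁ + 1)) := min_le_right _ _
    rw [le_div_iff₀ (by positivity)] at h
    nlinarith [hη_pos, hC₀, hC₁, h3d, hK₁_pos]
  have hηpow : η ^ (d - 2) ≤ η := by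
    calc η ^ (d - 2) ≤ η ^ 1 := pow_le_pow_of_le_one hη_pos.le hη1 (by omega)
      _ = η := pow_one η
  -- (3) uniform continuity away from the singularity, tolerance `ε₁ = ε / (4 (2π)^d)`
  set ε₁ : ℝ := ε / (4 * (2 * π) ^ d) with hε₁
  have hε₁_pos : 0 < ε₁ := by positivity
  have huc : UniformContinuousOn G (farRegion d (η / 2)) :=
    (isCompact_farRegion d (η / 2)).uniformContinuousOn_of_continuous
      (hG.mono (farRegion_subset_brillouin_diff (by positivity)))
  obtain ⟨η', hη', hUC⟩ := Metric.uniformContinuousOn_iff_le.1 huc ε₁ hε₁_pos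
  -- (4) the threshold
  set m : ℝ := min (η / 2) η' with hm
  have hm_pos : 0 < m := lt_min (by positivity) hη'
  obtain ⟨L₀, hL₀⟩ := exists_nat_gt (2 * π / m)
  refine ⟨L₀, fun L _ hLe hL₀L => ?_⟩
  have hL : 2 * π / m < L := lt_of_lt_of_le hL₀ (by exact_mod_cast hL₀L)
  have hLpos : (0 : ℝ) < L := lt_trans (by positivity) hL
  have hδ : gridStep L ≤ m := by
    unfold gridStep
    rw [div_le_iff₀ hLpos]
    rw [div_lt_iff₀ hm_pos] at hL
    linarith
  have hδη2 : gridStep L ≤ η / 2 := hδ.trans (min_le_left _ _)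
  have hδη' : gridStep L ≤ η' := hδ.trans (min_le_right _ _)
  have hδη : gridStep L ≤ η := by linarith
  have hδpos := gridStep_pos L
  have hδd : 0 ≤ gridStep L ^ d := pow_nonneg hδpos.le d
  set j₀ := centerIndex d L with hj₀
  set N := nearCells d L η with hN
  set A : TorusSite d L → E := fun j => (gridStep L) ^ d • G (cellCorner j) with hA
  set I : TorusSite d L → E := fun j => ∫ p in gridCell j, G p with hI'
  have hIsum : ∫ p in brillouin d, G p = ∑ j, I j := setIntegral_brillouin_eq_sum_gridCell' L hint
  -- split the index sets
  have hj₀N : j₀ ∈ N := by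
    refine Finset.mem_filter.2 ⟨mem_univ _, fun i => ?_⟩
    rw [hj₀, cellCorner_centerIndex d hLe]
    simp [hη_pos.le]
  have hsdiff : univ.erase j₀ \ N.erase j₀ = univ \ N := by
    ext j
    simp only [Finset.mem_sdiff, Finset.mem_erase, mem_univ, and_true, true_and, not_and]
    constructor
    · rintro ⟨hj, h⟩; exact h hj
    · intro h; exact ⟨fun hjj => h (hjj ▸ hj₀N), fun _ => h⟩
  have hsplitA : ∑ j ∈ univ.erase j₀, A j = ∑ j ∈ univ \ N, A j + ∑ j ∈ N.erase j₀, A j := by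
    rw [← Finset.sum_sdiff (Finset.erase_subset_erase j₀ (subset_univ N)), hsdiff]
  have hsplitI : ∑ j, I j = ∑ j ∈ univ \ N, I j + ∑ j ∈ N, I j := by
    rw [← Finset.sum_sdiff (subset_univ N)]
  -- (a) far cells
  have hfar : ∀ j ∈ univ \ N, ‖A j - I j‖ ≤ ε₁ * gridStep L ^ d := by
    intro j hj
    have hjN : j ∉ N := (Finset.mem_sdiff.1 hj).2
    have hsub := gridCell_subset_farRegion hδη2 hjN
    have hintj : IntegrableOn G (gridCell j) volume := hint.mono_set (gridCell_subset_brillouin j)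
    have hvol : volume.real (gridCell j) = gridStep L ^ d := by
      rw [Measure.real, volume_gridCell_toReal]
    have hc : IntegrableOn (fun _ : Fin d → ℝ => G (cellCorner j)) (gridCell j) volume :=
      integrableOn_const (hs := (volume_gridCell_lt_top j).ne)
    simp only [hA, hI']
    rw [smul_eq_setIntegral_const j, ← integral_sub hc hintj, ← hvol]
    refine norm_setIntegral_le_of_norm_le_const (volume_gridCell_lt_top j) fun p hp => ?_
    rw [← dist_eq_norm, dist_comm]
    exact hUC p (hsub hp) (cellCorner j) (hsub (cellCorner_mem_gridCell j))
      ((dist_cellCorner_le_of_mem_gridCell hp).trans hδη')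
  have hcardfar : (#(univ \ N) : ℝ) * gridStep L ^ d ≤ (2 * π) ^ d := by
    have h1 : (#(univ \ N) : ℝ) ≤ (L : ℝ) ^ d := by
      have := Finset.card_le_univ (univ \ N)
      rw [card_torusSite] at this
      exact_mod_cast this
    calc (#(univ \ N) : ℝ) * gridStep L ^ d ≤ (L : ℝ) ^ d * gridStep L ^ d := by gcongr
      _ = (2 * π) ^ d := by rw [← mul_pow, mul_comm, gridStep_mul]
  have ha : ∑ j ∈ univ \ N, ‖A j - I j‖ ≤ ε / 4 := by
    calc ∑ j ∈ univ \ N, ‖A j - I j‖ ≤ ∑ _j ∈ univ \ N, ε₁ * gridStep L ^ d := Finset.sum_le_sum hfar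
      _ = ε₁ * (#(univ \ N) * gridStep L ^ d) := by rw [sum_const, nsmul_eq_mul]; ring
      _ ≤ ε₁ * (2 * π) ^ d := by gcongr
      _ = ε / 4 := by rw [hε₁]; field_simp
  -- the near-cell count
  have hvolnear : (#N : ℝ) * gridStep L ^ d ≤ 3 ^ d * η := by
    have h1 := card_nearCells_mul_le (d := d) hLe hη_pos.le
    have h2 : (2 * η + gridStep L) ^ d ≤ (3 * η) ^ d := by
      gcongr
      linarith
    have h3 : (3 * η) ^ d ≤ 3 ^ d * η := by
      rw [mul_pow]
      gcongr
      calc η ^ d ≤ η ^ 1 := pow_le_pow_of_le_one hη_pos.le hη1 hd1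
        _ = η := pow_one η
    exact h1.trans (h2.trans h3)
  -- (b) near cells, grid part
  have hnearA : ∀ j ∈ N.erase j₀, ‖A j‖ ≤
      C₀ * gridStep L ^ d + C₁ * (gridStep L ^ d * |greenIntegrand (0 : Site d) (cellCorner j)|) := by
    intro j hj
    have hjj₀ : j ≠ j₀ := (Finset.mem_erase.1 hj).1
    have hc0 : cellCorner j ≠ 0 := cellCorner_ne_zero hLe hjj₀
    have hGc := hB (cellCorner j) (cellCorner_mem_brillouin j) hc0
    rw [abs_greenIntegrand_zero_eq]
    simp only [hA]
    rw [norm_smul, Real.norm_of_nonneg hδd]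
    calc gridStep L ^ d * ‖G (cellCorner j)‖ ≤ gridStep L ^ d * (C₀ + C₁ / dispersion (cellCorner j)) := by
          gcongr
      _ = C₀ * gridStep L ^ d + C₁ * (gridStep L ^ d * (1 / dispersion (cellCorner j))) := by ring
  have hb : ∑ j ∈ N.erase j₀, ‖A j‖ ≤ ε / 8 := by
    have hsing := sum_nearCells_abs_greenIntegrand_le d hd hLe (0 : Site d) hη_pos
    have hcardE : (#(N.erase j₀) : ℝ) ≤ #N := by exact_mod_cast Finset.card_erase_le
    calc ∑ j ∈ N.erase j₀, ‖A j‖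
        ≤ ∑ j ∈ N.erase j₀, (C₀ * gridStep L ^ d +
            C₁ * (gridStep L ^ d * |greenIntegrand (0 : Site d) (cellCorner j)|)) := Finset.sum_le_sum hnearA
      _ = C₀ * (#(N.erase j₀) * gridStep L ^ d) +
            C₁ * ∑ j ∈ N.erase j₀, gridStep L ^ d * |greenIntegrand (0 : Site d) (cellCorner j)| := by
          rw [Finset.sum_add_distrib, sum_const, nsmul_eq_mul, ← Finset.mul_sum]; ring
      _ ≤ C₀ * (#N * gridStep L ^ d) + C₁ * (K₁ * η ^ (d - 2)) := by
          gcongr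
      _ ≤ C₀ * (3 ^ d * η) + C₁ * (K₁ * η) := by gcongr
      _ = (C₀ * 3 ^ d + C₁ * K₁) * η := by ring
      _ ≤ ε / 8 := hηε
  -- (c) near cells, integral part
  have h0ae : ∀ᵐ p ∂(volume : Measure (Fin d → ℝ)), p ≠ (0 : Fin d → ℝ) := by
    haveI : Nonempty (Fin d) := ⟨⟨0, by omega⟩⟩
    have h0 : volume ({(0 : Fin d → ℝ)} : Set (Fin d → ℝ)) = 0 := measure_singleton 0
    filter_upwards [measure_eq_zero_iff_ae_notMem.1 h0] with p hp
    simpa using hp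
  have hnearI' : ∀ j ∈ N, ‖I j‖ ≤
      C₀ * gridStep L ^ d + C₁ * ∫ p in gridCell j, |greenIntegrand (0 : Site d) p| := by
    intro j _
    have hsubB := gridCell_subset_brillouin j
    have hintj : IntegrableOn G (gridCell j) volume := hint.mono_set hsubB
    have hI0j : IntegrableOn (fun p => |greenIntegrand (0 : Site d) p|) (gridCell j) volume :=
      (hI0.mono_set hsubB).abs
    have hvol : volume.real (gridCell j) = gridStep L ^ d := by
      rw [Measure.real, volume_gridCell_toReal]
    have hmaj : IntegrableOn (fun p => C₀ + C₁ * |greenIntegrand (0 : Site d) p|) (gridCell j) volume :=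
      (integrableOn_const (hs := (volume_gridCell_lt_top j).ne)).add (hI0j.const_mul C₁)
    have hae : ∀ᵐ p ∂(volume.restrict (gridCell j)), ‖G p‖ ≤ C₀ + C₁ * |greenIntegrand (0 : Site d) p| := by
      filter_upwards [ae_restrict_mem (measurableSet_gridCell j), ae_restrict_of_ae h0ae] with p hp hp0
      rw [abs_greenIntegrand_zero_eq]
      calc ‖G p‖ ≤ C₀ + C₁ / dispersion p := hB p (hsubB hp) hp0
        _ = C₀ + C₁ * (1 / dispersion p) := by ring
    simp only [hI']
    calc ‖∫ p in gridCell j, G p‖ ≤ ∫ p in gridCell j, ‖G p‖ := norm_integral_le_integral_norm _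
      _ ≤ ∫ p in gridCell j, (C₀ + C₁ * |greenIntegrand (0 : Site d) p|) :=
          integral_mono_ae hintj.norm hmaj hae
      _ = C₀ * gridStep L ^ d + C₁ * ∫ p in gridCell j, |greenIntegrand (0 : Site d) p| := by
          have hcst : IntegrableOn (fun _ : Fin d → ℝ => C₀) (gridCell j) volume :=
            integrableOn_const (hs := (volume_gridCell_lt_top j).ne)
          rw [integral_add hcst (hI0j.const_mul C₁), integral_const_mul, setIntegral_const, hvol, smul_eq_mul]
          ring
  have hc : ∑ j ∈ N, ‖I j‖ ≤ ε / 8 + ε / 8 := by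
    have hsum0 := sum_nearCells_integral_abs_le d hd (0 : Site d) hδη
    have hball := hnearI (2 * η) (by positivity) hηt
    calc ∑ j ∈ N, ‖I j‖ ≤ ∑ j ∈ N, (C₀ * gridStep L ^ d + C₁ * ∫ p in gridCell j, |greenIntegrand (0 : Site d) p|) :=
          Finset.sum_le_sum hnearI'
      _ = C₀ * (#N * gridStep L ^ d) + C₁ * ∑ j ∈ N, ∫ p in gridCell j, |greenIntegrand (0 : Site d) p| := by
          rw [Finset.sum_add_distrib, sum_const, nsmul_eq_mul, ← Finset.mul_sum]; ring
      _ ≤ C₀ * (3 ^ d * η) + C₁ * (ε / (8 * (C₁ + 1))) := by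
          gcongr
          exact hsum0.trans hball
      _ ≤ ε / 8 + ε / 8 := by
          have h0 : 0 ≤ C₁ * K₁ * η := by positivity
          have h1 : C₀ * (3 ^ d * η) ≤ ε / 8 := by nlinarith [hηε, h0]
          have h2 : C₁ * (ε / (8 * (C₁ + 1))) ≤ ε / 8 := by
            rw [mul_div_assoc']
            rw [div_le_div_iff₀ (by positivity) (by norm_num)]
            nlinarith [hε, hC₁]
          linarith
  -- combine
  rw [hIsum, show (∑ j ∈ univ.erase j₀, (gridStep L) ^ d • G (cellCorner j)) = ∑ j ∈ univ.erase j₀, A j from rfl,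
    hsplitA, hsplitI]
  have hre : ∑ j ∈ univ \ N, A j + ∑ j ∈ N.erase j₀, A j - (∑ j ∈ univ \ N, I j + ∑ j ∈ N, I j) =
      ∑ j ∈ univ \ N, (A j - I j) + ∑ j ∈ N.erase j₀, A j - ∑ j ∈ N, I j := by
    rw [Finset.sum_sub_distrib]; abel
  rw [hre]
  calc ‖∑ j ∈ univ \ N, (A j - I j) + ∑ j ∈ N.erase j₀, A j - ∑ j ∈ N, I j‖
      ≤ ‖∑ j ∈ univ \ N, (A j - I j)‖ + ‖∑ j ∈ N.erase j₀, A j‖ + ‖∑ j ∈ N, I j‖ := by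
        refine (norm_sub_le _ _).trans ?_
        gcongr
        exact norm_add_le _ _
    _ ≤ ∑ j ∈ univ \ N, ‖A j - I j‖ + ∑ j ∈ N.erase j₀, ‖A j‖ + ∑ j ∈ N, ‖I j‖ := by
        gcongr
        · exact norm_sum_le _ _
        · exact norm_sum_le _ _
        · exact norm_sum_le _ _
    _ ≤ ε / 4 + ε / 8 + (ε / 8 + ε / 8) := by gcongr
    _ ≤ ε := by linarith

/-- **Punctured momentum averages of a `2π`-periodic symbol with an integrable `1/ε` singularity converge to its
Brillouin-zone average** (`d ≥ 3`): `‖L^{-d} Σ_{k ≠ 0} G(2πk/L) − (2π)^{-d}∫_{[-π,π]^d} G‖ ≤ ε` for all EVEN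
`L ≥ L₀(ε)`.  This is the `T ↗ ℤ^d` step for the massive / Woodbury parts of the block propagators (symbols
`O(1/(N²ε(θ)))` at `θ → 0`, `WoodburyFibre.fibre_term_le`). [folklore] -/
theorem momentumAverage_singular_approx (hd : 3 ≤ d) {G : (Fin d → ℝ) → E} {C₀ C₁ : ℝ}
    (hC₀ : 0 ≤ C₀) (hC₁ : 0 ≤ C₁) (hG : ContinuousOn G (brillouin d \ {0}))
    (hB : ∀ p ∈ brillouin d, p ≠ 0 → ‖G p‖ ≤ C₀ + C₁ / dispersion p)
    (hper : ∀ (p : Fin d → ℝ) (n : Fin d → ℤ), G (fun i => p i + 2 * π * (n i : ℝ)) = G p)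
    {ε : ℝ} (hε : 0 < ε) :
    ∃ L₀ : ℕ, ∀ (L : ℕ) [NeZero L], Even L → L₀ ≤ L →
      ‖((L ^ d : ℕ) : ℝ)⁻¹ • ∑ k ∈ (univ : Finset (TorusSite d L)).erase 0, G (latticeMomentum L k) -
          ((2 * π) ^ d)⁻¹ • ∫ p in brillouin d, G p‖ ≤ ε := by
  have h2π : (0 : ℝ) < (2 * π) ^ d := by positivity
  obtain ⟨L₀, hL₀⟩ := cornerRiemannSum_singular_approx hd hC₀ hC₁ hG hB (ε := (2 * π) ^ d * ε) (by positivity)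
  refine ⟨L₀, fun L _ hev hL => ?_⟩
  have h := hL₀ L hev hL
  -- reindex the punctured momentum sum as the punctured corner sum
  have hfull : ∑ k : TorusSite d L, G (latticeMomentum L k) = ∑ j : TorusSite d L, G (cellCorner j) :=
    sum_latticeMomentum_eq_sum_cellCorner hev hper
  have hsum : ∑ k ∈ (univ : Finset (TorusSite d L)).erase 0, G (latticeMomentum L k) =
      ∑ j ∈ (univ : Finset (TorusSite d L)).erase (centerIndex d L), G (cellCorner j) := by
    rw [Finset.sum_erase_eq_sub (mem_univ _), Finset.sum_erase_eq_sub (mem_univ _), hfull,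
      latticeMomentum_zero, cellCorner_centerIndex d hev]
  have hL0 : (L : ℝ) ^ d ≠ 0 := pow_ne_zero d (by exact_mod_cast NeZero.ne L)
  have hcs : (∑ j ∈ (univ : Finset (TorusSite d L)).erase (centerIndex d L), (gridStep L) ^ d • G (cellCorner j)) =
      (2 * π) ^ d • (((L ^ d : ℕ) : ℝ)⁻¹ •
        ∑ k ∈ (univ : Finset (TorusSite d L)).erase 0, G (latticeMomentum L k)) := by
    rw [← Finset.smul_sum, hsum, smul_smul]
    congr 1
    rw [← gridStep_mul L, mul_pow]
    push_cast
    rw [mul_inv_cancel_right₀ hL0]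
  have key : (2 * π) ^ d • (((L ^ d : ℕ) : ℝ)⁻¹ •
        ∑ k ∈ (univ : Finset (TorusSite d L)).erase 0, G (latticeMomentum L k) -
      ((2 * π) ^ d)⁻¹ • ∫ p in brillouin d, G p) =
      (∑ j ∈ (univ : Finset (TorusSite d L)).erase (centerIndex d L), (gridStep L) ^ d • G (cellCorner j)) -
        ∫ p in brillouin d, G p := by
    rw [smul_sub, hcs, ← mul_smul ((2 * π) ^ d) (((2 * π) ^ d)⁻¹), mul_inv_cancel₀ h2π.ne', one_smul]
  have hn : ‖(2 * π) ^ d • (((L ^ d : ℕ) : ℝ)⁻¹ •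
        ∑ k ∈ (univ : Finset (TorusSite d L)).erase 0, G (latticeMomentum L k) -
      ((2 * π) ^ d)⁻¹ • ∫ p in brillouin d, G p)‖ ≤ (2 * π) ^ d * ε := by
    rw [key]; exact h
  rw [norm_smul, Real.norm_of_nonneg h2π.le] at hn
  exact le_of_mul_le_mul_left hn h2π

end Literature.MathematicalPhysics.QuantumFieldTheory.Balaban1983to89.Beta.PuncturedRiemannSum

end
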